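import Literature.NumberTheory.DiophantineGeometry.GenEllFullGalois
import Literature.NumberTheory.DiophantineGeometry.StableFaltingsHeightMapProofs
import Literature.IUT.LogVolume.PrincipalArithmeticDivisors
import HarnessLib

/-!
# [GenEll] Thm. 3.8, proof, step 1: invariants of `E_L` under base change `E_{L′} = E_L ×_L L′`

S. Mochizuki, *Arithmetic elliptic curves in general position*, Math. J. Okayama Univ. 52 (2010)
[cite: MochizukiGenEll2010], proof of Theorem 3.8, p. 20: "there exists a Galois extension `L′` of
`L` of degree that divides `d₀ = 23040` […] we may assume that `E_{L′} = E_L ×_L L′` has semi-stable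
reduction at all of the finite primes of `L`.  [Here, we note that passing to such a Galois extension
of `L` only affects the prime decomposition of the local heights via the primes that divide `d₀`,
of which there are only finitely many, namely, `2`, `3`, and `5`.]"

Topic `NumberTheory/DiophantineGeometry`.  Theorem-only file (no definition, no named fact): the
bookkeeping behind "we may assume", i.e. how the data of the presented point `P = (E/L)`
(`GenEll.EllPoint`) compare with those of `P′ = ⟨L′, E ×_L L′⟩` (`P′.W = P.W.map (algebraMap L L′)`,
Mathlib's `W.baseChange L′` by `rfl`) for a finite extension `L′/L` of number fields:

* `degree_baseChange` — `[L′:ℚ] = [L′:L]·[L:ℚ]`;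
* `j_baseChange`, `mellExcMem_baseChange_iff` — same `j`, same minimal polynomial, so the same
  membership in any exceptional set `Exc`; `mem_baseChange` — `[E] ∈ K_V ⟹ [E_{L′}] ∈ K_V`;
* `htFalt_baseChange` — `ht^Falt` is unchanged (tree theorem `stableFaltingsHeight_map_holds`);
* `degInf_baseChange` — `deg_∞` is unchanged (`N(𝔇 𝓞_{L′}) = N(𝔇)^{[L′:L]}`);
* `localHeight_baseChange` — `h_w(E_{L′}) = e(w|v) · h_v(E)` (L6-t16's `ord_algebraMap`), hence
  `isPotMult_baseChange_iff`, `hasPotMultPlace_baseChange`, and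
  `not_dvd_localHeight_baseChange` — a prime `l ∤ h_v` with `l ∤ e(w|v)` does not divide `h_w`.

The Galois-image comparison is `GenEllBaseChangeGalois.lean`.

## References

* S. Mochizuki, op. cit., proof of Thm. 3.8, p. 20. [MochizukiGenEll2010]
-/

noncomputable section

open NumberField IsDedekindDomain

namespace Literature.NumberTheory.DiophantineGeometry.GenEll

namespace EllPoint

open Literature.IUT.LogVolume

variable (P : EllPoint) (L' : Type) [Field L'] [NumberField L'] [Algebra P.F L']

/-- `[L′:ℚ] = [L′:L]·[L:ℚ]`. [cite: MochizukiGenEll2010, Thm 3.8 proof p.20] -/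
theorem degree_baseChange :
    ({ F := L', W := P.W.map (algebraMap P.F L') } : EllPoint).degree =
      Module.finrank P.F L' * P.degree := by
  unfold EllPoint.degree
  change Module.finrank ℚ L' = Module.finrank P.F L' * Module.finrank ℚ P.F
  rw [mul_comm, Module.finrank_mul_finrank]

/-- `j(E_{L′}) = j(E)`. [cite: MochizukiGenEll2010, Thm 3.8 proof p.20] -/
theorem j_baseChange :
    ({ F := L', W := P.W.map (algebraMap P.F L') } : EllPoint).W.j = algebraMap P.F L' P.W.j :=
  P.W.map_j _

/-- `[E_{L′}] ∈ Exc ⟺ [E] ∈ Exc` for an exceptional set `Exc` of minimal polynomials of `j`.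
[cite: MochizukiGenEll2010, Thm 3.8 proof p.20] -/
theorem mellExcMem_baseChange_iff (Exc : Set (Polynomial ℚ)) :
    MellExcMem Exc ({ F := L', W := P.W.map (algebraMap P.F L') } : EllPoint) ↔ MellExcMem Exc P := by
  unfold MellExcMem
  change minpoly ℚ (P.W.map (algebraMap P.F L')).j ∈ Exc ↔ minpoly ℚ P.W.j ∈ Exc
  rw [P.W.map_j, minpoly.algebraMap_eq (algebraMap P.F L').injective]

/-- `[E] ∈ K_V ⟹ [E_{L′}] ∈ K_V` (every embedding of `L′` restricts to one of `L`).
[cite: MochizukiGenEll2010, Thm 3.8 proof p.20] -/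
theorem mem_baseChange (D : MellCBData) (h : D.Mem P) :
    D.Mem ({ F := L', W := P.W.map (algebraMap P.F L') } : EllPoint) := by
  obtain ⟨harc, hnon⟩ := h
  constructor
  · intro σ
    change σ (P.W.map (algebraMap P.F L')).j ∈ D.Karc
    rw [P.W.map_j]
    exact harc (σ.comp (algebraMap P.F L'))
  · intro p hp _ σ
    change σ (P.W.map (algebraMap P.F L')).j ∈ D.Knon p
    rw [P.W.map_j]
    exact hnon p hp (σ.comp (algebraMap P.F L'))

/-- `ht^Falt([E_{L′}]) = ht^Falt([E])` (the stable Faltings height is invariant under base change,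
tree theorem `stableFaltingsHeight_map_holds`). [cite: MochizukiGenEll2010, Thm 3.8 proof p.20] -/
theorem htFalt_baseChange :
    ({ F := L', W := P.W.map (algebraMap P.F L') } : EllPoint).htFalt = P.htFalt :=
  WeierstrassCurve.stableFaltingsHeight_map_holds P.W

/-- `deg_∞([E_{L′}]) = deg_∞([E])` (`N(𝔇 𝓞_{L′}) = N(𝔇)^{[L′:L]}`, `[L′:ℚ] = [L′:L]·[L:ℚ]`).
[cite: MochizukiGenEll2010, Thm 3.8 proof p.20] -/
theorem degInf_baseChange :
    ({ F := L', W := P.W.map (algebraMap P.F L') } : EllPoint).degInf = P.degInf := by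
  unfold EllPoint.degInf
  rw [degree_baseChange]
  change ((Module.finrank P.F L' * P.degree : ℕ) : ℝ)⁻¹ *
      Real.log (Ideal.absNorm (P.W.map (algebraMap P.F L')).jDenominatorIdeal) = _
  rw [WeierstrassCurve.absNorm_jDenominatorIdeal_map, Nat.cast_pow, Real.log_pow, Nat.cast_mul]
  have hk : (Module.finrank P.F L' : ℝ) ≠ 0 := by
    haveI : Module.Finite P.F L' := Module.Finite.of_restrictScalars_finite ℚ P.F L'
    exact_mod_cast Module.finrank_pos.ne'
  have hd : (P.degree : ℝ) ≠ 0 := by exact_mod_cast P.degree_pos.ne'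
  field_simp

/-- **`h_w(E_{L′}) = e(w|v) · h_v(E)`** for a finite prime `w` of `L′` over `v` of `L`
(`ord_w(j) = e(w|v)·ord_v(j)`). [cite: MochizukiGenEll2010, Thm 3.8 proof p.20] -/
theorem localHeight_baseChange (w : HeightOneSpectrum (𝓞 L')) :
    ({ F := L', W := P.W.map (algebraMap P.F L') } : EllPoint).localHeight w =
      (Ideal.ramificationIdx' (finBelow P.F L' w).asIdeal w.asIdeal : ℤ) *
        P.localHeight (finBelow P.F L' w) := by
  unfold EllPoint.localHeight
  change -ord L' w (P.W.map (algebraMap P.F L')).j = _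
  rw [P.W.map_j, ord_algebraMap]
  ring

/-- The ramification index `e(w|v)` is positive. [folklore] -/
private theorem ramificationIdx'_finBelow_pos (w : HeightOneSpectrum (𝓞 L')) :
    0 < Ideal.ramificationIdx' (finBelow P.F L' w).asIdeal w.asIdeal := by
  haveI : w.asIdeal.IsPrime := w.isPrime
  exact Nat.pos_of_ne_zero
    (Ideal.IsDedekindDomain.ramificationIdx'_ne_zero_of_liesOver w.asIdeal (finBelow P.F L' w).ne_bot)

/-- **`w` is a prime of potentially multiplicative reduction of `E_{L′}` iff `v = w ∩ L` is one of
`E`**. [cite: MochizukiGenEll2010, Thm 3.8 proof p.20] -/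
theorem isPotMult_baseChange_iff (w : HeightOneSpectrum (𝓞 L')) :
    ({ F := L', W := P.W.map (algebraMap P.F L') } : EllPoint).IsPotMult w ↔
      P.IsPotMult (finBelow P.F L' w) := by
  unfold EllPoint.IsPotMult
  rw [localHeight_baseChange]
  have he := P.ramificationIdx'_finBelow_pos L' w
  constructor
  · intro h
    by_contra hle
    rw [not_lt] at hle
    have : (Ideal.ramificationIdx' (finBelow P.F L' w).asIdeal w.asIdeal : ℤ) *
        P.localHeight (finBelow P.F L' w) ≤ 0 :=
      mul_nonpos_of_nonneg_of_nonpos (by exact_mod_cast he.le) hle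
    linarith
  · intro h
    exact mul_pos (by exact_mod_cast he) h

/-- **`E` has a prime of potentially multiplicative reduction ⟹ so does `E_{L′}`** (take any
prime of `L′` over it). [cite: MochizukiGenEll2010, Thm 3.8 proof p.20] -/
theorem hasPotMultPlace_baseChange (h : P.HasPotMultPlace) :
    ({ F := L', W := P.W.map (algebraMap P.F L') } : EllPoint).HasPotMultPlace := by
  obtain ⟨v, hv⟩ := h
  haveI := v.isMaximal
  obtain ⟨Q, hQmax, hQover⟩ :=
    Ideal.exists_maximal_ideal_liesOver_of_isIntegral (S := 𝓞 L') v.asIdeal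
  have hQne : Q ≠ ⊥ := by
    intro hQ
    apply v.ne_bot
    have := hQover.over
    rw [hQ, Ideal.under_bot] at this
    exact this
  set w : HeightOneSpectrum (𝓞 L') := ⟨Q, hQmax.isPrime, hQne⟩ with hw
  have hbelow : finBelow P.F L' w = v := by
    apply HeightOneSpectrum.ext
    change w.asIdeal.under (𝓞 P.F) = v.asIdeal
    exact hQover.over.symm
  refine ⟨w, ?_⟩
  rw [isPotMult_baseChange_iff, hbelow]
  exact hv

/-- **"passing to `L′` only affects the prime decomposition of the local heights via the primes
dividing `[L′:L]`"**: if a prime `l` divides neither `h_v(E)` nor the ramification index `e(w|v)`,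
it does not divide `h_w(E_{L′})`. [cite: MochizukiGenEll2010, Thm 3.8 proof p.20] -/
theorem not_dvd_localHeight_baseChange {l : ℕ} (hl : l.Prime) (w : HeightOneSpectrum (𝓞 L'))
    (hv : ¬ ((l : ℤ) ∣ P.localHeight (finBelow P.F L' w)))
    (he : ¬ (l ∣ Ideal.ramificationIdx' (finBelow P.F L' w).asIdeal w.asIdeal)) :
    ¬ ((l : ℤ) ∣ ({ F := L', W := P.W.map (algebraMap P.F L') } : EllPoint).localHeight w) := by
  rw [localHeight_baseChange]
  intro hdvd
  rcases (Nat.prime_iff_prime_int.mp hl).dvd_or_dvd hdvd with h | h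
  · exact he (Int.natCast_dvd_natCast.mp h)
  · exact hv h

end EllPoint

end Literature.NumberTheory.DiophantineGeometry.GenEll
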